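/-
Origin: expansion seat `planner-pub-hodgecm-pv12-g7-0`, handover import Pv12g7.FockPrintGenuineTorus -> HodgeCM.PerL34.FockPrintGenuineTorus (x1; the four Mathlib.Analysis.* imports stay) ; after FockPrintGenuineTorus (pv12-g7 #8, 451056216dafba54368efce59d05d35e); HOLD iff #8 is held (`HOME/pub-hodgecm-pv12-g7/lean/Pv12g7/FockPrintTorusGenerator.lean`, md5 717f5f96, 212 lines);
landed by the gen-8 packager in gate run 29 as `HodgeCM/PerL34/FockPrintTorusGenerator.lean` (import ^import Pv12g7\.FockPrintGenuineTorus[ \t]*$→import HodgeCM.PerL34.FockPrintGenuineTorus ×1).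
-/
import Summits.HodgeConjecture.HodgeCM.PerL34.FockPrintGenuineTorus
import Mathlib.Analysis.SpecialFunctions.ExpDeriv
import Mathlib.Analysis.Complex.RealDeriv
import Mathlib.Analysis.Calculus.Deriv.Add
import Mathlib.Analysis.Calculus.Deriv.Mul

/-!
# FockPrintTorusGenerator — `ArchB.weightOp s` IS the infinitesimal generator of the genuine unitary torus
`θ ↦ ν₀(diag(e^{−iθ s_k}))` of Folland's `L²` Fock model (the INFINITESIMAL half of the exponentiation dictionary)

Cell `pub-hodgecm`, seat `planner-pub-hodgecm-pv12-g7-0` (DAG-NODE PROVER #12 gen 7, Fock-model seat), file #9 (RUN 30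
queue; lands AFTER #8 `HodgeCM/PerL34/FockPrintGenuineTorus.lean`).  KERNEL ONLY — nothing is cited, no hypothesis is
introduced, no statement of another seat is touched.  Imports: this seat's #8 (WIP name `Pv12g7.FockPrintGenuineTorus` ↦
`HodgeCM.PerL34.FockPrintGenuineTorus` at landing) and four Mathlib calculus files.

## Source (PerL v5, `HOME/inputs/2001/…PerL-v5-FULL-d912a121.tex`, verbatim) and what is being made honest

* l. 485–486 (L4.1(b)): "$T_b=\U(W_{1,b})\times\U(W_{2,b})$ acts by the character $-w_b$"; ll. 505–511: the Fock model
  $\mathcal F_b=\mathbb C[z_{aj},w_j]$, "$U(W_{j,b})=U(1)$: $z_{aj}\mapsto u z_{aj}$, $w_j\mapsto u^{-1}w_j$" (tree: `ArchB.colWt`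
  docstring), "$T'_{\iota_1}$ acts by $\det$".
* In the tree the WEIGHTS of L4.1(b)/(c) are computed with the polynomial operator `ArchB.weightOp s = Σ_k s_k X_k ∂_k`
  (`coeff_weightOp : coeff m (weightOp s F) = wt s m · coeff m F`).  File #8 proved the GLOBAL half of the dictionary: a
  `weightOp s`-eigenvector of integer weight `n` is a genuine eigenvector of `u ↦ ν₀(torusU s u)` with character `u^n`.
  This file proves the INFINITESIMAL half, which is what licenses calling `weightOp s` "the infinitesimal action of the
  torus" at all: on every polynomial vector `F·e^{−(π/2)|z|²}` of the honest Hilbert space `𝓕_σ ⊂ L²(ℂ^σ)` the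
  one-parameter unitary group `θ ↦ ν₀(torusU s (e^{iθ}))` is differentiable and

      d/dθ ν₀(torusU s (e^{iθ})) (F·e^{−…}) = ν₀(torusU s (e^{iθ})) ( i · (weightOp s F)·e^{−…} ),

  in particular `d/dθ|_{θ=0} = i · (weightOp s F)·e^{−(π/2)|z|²}` — i.e. `weightOp s = −i·(d/dθ)|₀` of the genuine group on
  the (dense, pv05 `fockToL2_denseRange`) polynomial domain: the restriction of Stone's generator.

## Contents

* §1 monomials are genuine weight vectors (`fockRep_torusU_fockToL2_monomial`, from the tree's `Fock.weightOp_monomial`), the monomial expansions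
  `fockRep_torusU_fockToL2_eq_sum` / `fockToL2_weightOp_eq_sum`.
* §2 the scalar phase `torusPhase n θ = e^{i n θ}`: `coe_exp_zpow : ↑((Circle.exp θ)^n) = torusPhase n θ` and its derivative
  `hasDerivAt_torusPhase`.
* §3 **`hasDerivAt_fockRep_torusU_exp`** (the displayed formula at every `θ₀`), **`hasDerivAt_fockRep_torusU_exp_zero`**,
  `deriv_fockRep_torusU_exp_zero`, and the recovery formula **`fockToL2_weightOp_eq_deriv :
  fockToL2 (weightOp s F) = (−i) • deriv (θ ↦ ν₀(torusU s (e^{iθ}))(fockToL2 F)) 0`** — the infinitesimal weight operator of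
  the `FockPrint*` leaves is DETERMINED by Folland's genuine representation.
* §4 plane model at `ι₁`: the two factors `U(W_{j,ι₁})` of `T_{ι₁}` (`planeTorusHom` of #8) have infinitesimal generators
  `i·weightOp (colWt j)` (`hasDerivAt_fockRep_planeTorus_fst/snd`), so the column weights used throughout `ArchB` /
  `FockPrint*` are the HONEST infinitesimal characters `dν₀` of the genuine torus; e.g. on `det z` both equal `i·det z`
  (`hasDerivAt_fockRep_planeTorus_fst_detZ`).

Honest scope: as in #8 — the identification of `T_b` with the diagonal torus of exponents `colWt` is the tree's dictionary
(PerL l. 505); nothing here concerns which characters occur in θ-lifts (N27/N29).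
-/

set_option autoImplicit false

namespace HodgeCM.PerL34.Fock.PrintDict

open MvPolynomial Complex

section General

variable {σ : Type*} [Fintype σ] [DecidableEq σ]

/-! ## §1  Monomials are genuine weight vectors; monomial expansions -/

/-- A monomial is a genuine eigenvector of the torus with character `u^{wt(s,m)}` (#8 applied to the tree's
`Fock.weightOp_monomial`, `HodgeCM/PerL34/FockKTypes.lean`). -/
theorem fockRep_torusU_fockToL2_monomial (s : σ → ℤ) (m : σ →₀ ℕ) (c : ℂ) (u : Circle) :
    Hermite.fockRep (torusU s u) (Hermite.fockToL2 (monomial m c))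
      = ((u ^ wt s m : Circle) : ℂ) • Hermite.fockToL2 (monomial m c) :=
  fockRep_torusU_fockToL2_of_weightOp s (weightOp_monomial s m c) u

/-- The `L²` image of the `m`-th monomial term of `F`. -/
noncomputable def monVec (F : MvPolynomial σ ℂ) (m : σ →₀ ℕ) : Hermite.FockL2 σ :=
  Hermite.fockToL2 (monomial m (coeff m F))

omit [DecidableEq σ] in
/-- (Ported verbatim from the HodgeCMPerL package; no docstring in the source.) -/
theorem fockToL2_eq_sum_monVec (F : MvPolynomial σ ℂ) :
    Hermite.fockToL2 F = ∑ m ∈ F.support, monVec F m := by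
  conv_lhs => rw [F.as_sum]
  rw [map_sum]
  rfl

/-- Monomial expansion of the genuine torus action on `F·e^{−(π/2)|z|²}`. -/
theorem fockRep_torusU_fockToL2_eq_sum (s : σ → ℤ) (F : MvPolynomial σ ℂ) (u : Circle) :
    Hermite.fockRep (torusU s u) (Hermite.fockToL2 F)
      = ∑ m ∈ F.support, ((u ^ wt s m : Circle) : ℂ) • monVec F m := by
  rw [fockToL2_eq_sum_monVec, map_sum]
  exact Finset.sum_congr rfl fun m _ => fockRep_torusU_fockToL2_monomial s m (coeff m F) u

/-- Monomial expansion of `(weightOp s F)·e^{−(π/2)|z|²}`. -/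
theorem fockToL2_weightOp_eq_sum (s : σ → ℤ) (F : MvPolynomial σ ℂ) :
    Hermite.fockToL2 (weightOp s F) = ∑ m ∈ F.support, (wt s m : ℂ) • monVec F m := by
  conv_lhs => rw [F.as_sum]
  rw [map_sum, map_sum]
  refine Finset.sum_congr rfl fun m _ => ?_
  rw [weightOp_monomial, map_smul]
  rfl

/-! ## §2  The scalar phase `θ ↦ e^{i n θ}` and its derivative -/

/-- `torusPhase n θ = e^{i n θ}`. -/
noncomputable def torusPhase (n : ℤ) (θ : ℝ) : ℂ := Complex.exp ((n : ℂ) * ((θ : ℂ) * I))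

/-- (Ported verbatim from the HodgeCMPerL package; no docstring in the source.) -/
theorem coe_exp_zpow (n : ℤ) (θ : ℝ) : ((Circle.exp θ ^ n : Circle) : ℂ) = torusPhase n θ := by
  rw [Circle.coe_zpow, Circle.coe_exp, ← Complex.exp_int_mul]
  rfl

/-- (Ported verbatim from the HodgeCMPerL package; no docstring in the source.) -/
theorem torusPhase_zero_right (n : ℤ) : torusPhase n 0 = 1 := by
  rw [torusPhase, ofReal_zero, zero_mul, mul_zero, Complex.exp_zero]

/-- `d/dθ e^{i n θ} = e^{i n θ} · (i n)`. -/
theorem hasDerivAt_torusPhase (n : ℤ) (θ₀ : ℝ) :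
    HasDerivAt (torusPhase n) (torusPhase n θ₀ * ((n : ℂ) * I)) θ₀ := by
  have h1 : HasDerivAt (fun θ : ℝ => ((θ : ℝ) : ℂ)) ((1 : ℝ) : ℂ) θ₀ := (hasDerivAt_id θ₀).ofReal_comp
  have h2 : HasDerivAt (fun θ : ℝ => (n : ℂ) * (((θ : ℝ) : ℂ) * I)) ((n : ℂ) * (((1 : ℝ) : ℂ) * I)) θ₀ :=
    (h1.mul_const I).const_mul (n : ℂ)
  have h3 := h2.cexp
  refine h3.congr_deriv ?_
  rw [ofReal_one, one_mul]
  rfl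

/-! ## §3  `weightOp s` is the infinitesimal generator of `θ ↦ ν₀(torusU s (e^{iθ}))` on polynomial vectors -/

/-- **The infinitesimal dictionary.**  For every polynomial `F` and exponents `s : σ → ℤ`, the genuine one-parameter
unitary group `θ ↦ ν₀(torusU s (e^{iθ}))` of Folland's representation is differentiable on the honest vector
`F·e^{−(π/2)|z|²} ∈ 𝓕_σ ⊂ L²(ℂ^σ)`, with derivative at `θ₀` equal to `ν₀(torusU s (e^{iθ₀}))` of `i·(weightOp s F)·e^{−…}`. -/
theorem hasDerivAt_fockRep_torusU_exp (s : σ → ℤ) (F : MvPolynomial σ ℂ) (θ₀ : ℝ) :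
    HasDerivAt (fun θ : ℝ => Hermite.fockRep (torusU s (Circle.exp θ)) (Hermite.fockToL2 F))
      (Hermite.fockRep (torusU s (Circle.exp θ₀)) (I • Hermite.fockToL2 (weightOp s F))) θ₀ := by
  have hfun : (fun θ : ℝ => Hermite.fockRep (torusU s (Circle.exp θ)) (Hermite.fockToL2 F))
      = fun θ : ℝ => ∑ m ∈ F.support, torusPhase (wt s m) θ • monVec F m := by
    funext θ
    rw [fockRep_torusU_fockToL2_eq_sum]
    exact Finset.sum_congr rfl fun m _ => by rw [coe_exp_zpow]
  have hsum : HasDerivAt (fun θ : ℝ => ∑ m ∈ F.support, torusPhase (wt s m) θ • monVec F m)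
      (∑ m ∈ F.support, (torusPhase (wt s m) θ₀ * ((wt s m : ℂ) * I)) • monVec F m) θ₀ :=
    HasDerivAt.fun_sum fun m _ => (hasDerivAt_torusPhase (wt s m) θ₀).smul_const (monVec F m)
  rw [hfun]
  refine hsum.congr_deriv ?_
  rw [LinearIsometryEquiv.map_smul, fockToL2_weightOp_eq_sum, map_sum, Finset.smul_sum]
  refine Finset.sum_congr rfl fun m _ => ?_
  rw [LinearIsometryEquiv.map_smul, monVec, fockRep_torusU_fockToL2_monomial, coe_exp_zpow, smul_smul, smul_smul]
  congr 1
  ring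

/-- **At `θ = 0`: `d/dθ|₀ ν₀(torusU s (e^{iθ}))(F·e^{−…}) = i·(weightOp s F)·e^{−…}`.** -/
theorem hasDerivAt_fockRep_torusU_exp_zero (s : σ → ℤ) (F : MvPolynomial σ ℂ) :
    HasDerivAt (fun θ : ℝ => Hermite.fockRep (torusU s (Circle.exp θ)) (Hermite.fockToL2 F))
      (I • Hermite.fockToL2 (weightOp s F)) 0 := by
  have h := hasDerivAt_fockRep_torusU_exp s F 0
  rw [Circle.exp_zero, torusU_one, Hermite.fockRep_apply, Hermite.fockOp_one] at h
  exact h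

/-- (Ported verbatim from the HodgeCMPerL package; no docstring in the source.) -/
theorem deriv_fockRep_torusU_exp_zero (s : σ → ℤ) (F : MvPolynomial σ ℂ) :
    deriv (fun θ : ℝ => Hermite.fockRep (torusU s (Circle.exp θ)) (Hermite.fockToL2 F)) 0
      = I • Hermite.fockToL2 (weightOp s F) :=
  (hasDerivAt_fockRep_torusU_exp_zero s F).deriv

/-- **Recovery formula: `weightOp s = −i·(d/dθ)|₀` of the genuine torus** on the polynomial vectors — the infinitesimal
weight operator of `ArchB` / the `FockPrint*` leaves is DETERMINED by Folland's unitary representation `ν₀`. -/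
theorem fockToL2_weightOp_eq_deriv (s : σ → ℤ) (F : MvPolynomial σ ℂ) :
    Hermite.fockToL2 (weightOp s F)
      = (-I) • deriv (fun θ : ℝ => Hermite.fockRep (torusU s (Circle.exp θ)) (Hermite.fockToL2 F)) 0 := by
  rw [deriv_fockRep_torusU_exp_zero, smul_smul, neg_mul, I_mul_I, neg_neg, one_smul]

end General

/-! ## §4  Plane model at `ι₁`: the column weights are the honest infinitesimal characters of the two factors of `T_{ι₁}` -/

section Plane

/-- The first factor `U(W_{1,ι₁})` of `T_{ι₁}`: `d/dθ|₀ ν₀(planeTorusHom (e^{iθ}, 1)) = i·weightOp (colWt 0)` on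
polynomial vectors. -/
theorem hasDerivAt_fockRep_planeTorus_fst (F : PlaneModel) :
    HasDerivAt (fun θ : ℝ => Hermite.fockRep (planeTorusHom (Circle.exp θ, 1)) (Hermite.fockToL2 F))
      (I • Hermite.fockToL2 (weightOp (colWt 0) F)) 0 := by
  have hfun : (fun θ : ℝ => Hermite.fockRep (planeTorusHom (Circle.exp θ, 1)) (Hermite.fockToL2 F))
      = fun θ : ℝ => Hermite.fockRep (torusU (colWt 0) (Circle.exp θ)) (Hermite.fockToL2 F) := by
    funext θ
    rw [planeTorusHom_apply, torusU_one, mul_one]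
  rw [hfun]
  exact hasDerivAt_fockRep_torusU_exp_zero (colWt 0) F

/-- The second factor `U(W_{2,ι₁})`: `d/dθ|₀ ν₀(planeTorusHom (1, e^{iθ})) = i·weightOp (colWt 1)`. -/
theorem hasDerivAt_fockRep_planeTorus_snd (F : PlaneModel) :
    HasDerivAt (fun θ : ℝ => Hermite.fockRep (planeTorusHom (1, Circle.exp θ)) (Hermite.fockToL2 F))
      (I • Hermite.fockToL2 (weightOp (colWt 1) F)) 0 := by
  have hfun : (fun θ : ℝ => Hermite.fockRep (planeTorusHom (1, Circle.exp θ)) (Hermite.fockToL2 F))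
      = fun θ : ℝ => Hermite.fockRep (torusU (colWt 1) (Circle.exp θ)) (Hermite.fockToL2 F) := by
    funext θ
    rw [planeTorusHom_apply, torusU_one, one_mul]
  rw [hfun]
  exact hasDerivAt_fockRep_torusU_exp_zero (colWt 1) F

/-- On `det z` both factors of `T_{ι₁}` have infinitesimal character `i` (weight `1`, PerL l. 510 "acts by det",
infinitesimally and genuinely): `d/dθ|₀ ν₀(planeTorusHom (e^{iθ},1)) (det z·e^{−…}) = i·(det z·e^{−…})`. -/
theorem hasDerivAt_fockRep_planeTorus_fst_detZ :
    HasDerivAt (fun θ : ℝ => Hermite.fockRep (planeTorusHom (Circle.exp θ, 1)) (Hermite.fockToL2 detZ))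
      (I • Hermite.fockToL2 detZ) 0 := by
  have h := hasDerivAt_fockRep_planeTorus_fst detZ
  rw [weightOp_colWt_detZ] at h
  exact h

/-- (Ported verbatim from the HodgeCMPerL package; no docstring in the source.) -/
theorem hasDerivAt_fockRep_planeTorus_snd_detZ :
    HasDerivAt (fun θ : ℝ => Hermite.fockRep (planeTorusHom (1, Circle.exp θ)) (Hermite.fockToL2 detZ))
      (I • Hermite.fockToL2 detZ) 0 := by
  have h := hasDerivAt_fockRep_planeTorus_snd detZ
  rw [weightOp_colWt_detZ] at h
  exact h

end Plane

end HodgeCM.PerL34.Fock.PrintDict
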